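import Literature.MathematicalPhysics.QuantumFieldTheory.Balaban1983to89.Node00.OpsYOfLetters

/-!
# NODE 00 — `Node00.OpsYHolderFar`: the FAR-PAIR CALCULUS of def-Y's covariant Hölder readers (3.40) — intro ∕ elim rules for the site
# quotient `hqS` (ALL pairs of the member torus) and the bond quotient `holderQB` (ADMISSIBLE pairs only), the near ∕ far split
# «uncut = cut + point terms», and the cut reader `hqSCut`

T. Bałaban, *Propagators for lattice gauge theories in a background field*, Commun. Math. Phys. **99** (1985) 389–434
[`Balaban1985BackgroundPropagators`, "B9"]; [4] = T. Bałaban, *Propagators and renormalization transformations for lattice gauge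
theories. II*, Commun. Math. Phys. **96** (1984) 223–250 [`Balaban1984PropagatorsII`]; [I] = part I, Commun. Math. Phys. **95** (1984) 17–40
[`Balaban1984PropagatorsI`].

statement-level skeleton of published theorems with citation tags; proofs where landed; nothing here is a claim about the
Yang–Mills mass gap

THE PRINTED LOCI.  [B9] (3.40) p. 397: the covariant Hölder quotients *«‖λ‖_α = sup_{x,x′: |x−x′| ≦ 1} |R(U(Γ_{x,x′}))λ(x′) − λ(x)| ∕ |x − x′|^α»*,
*«It is understood that the η-scale is used in the above definitions. If we use another scale, then it is indicated explicitly by a superscript,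
e.g. ‖·‖^ξ»*; (3.43) p. 398 (*«‖ζ∇_U G′(U)λ‖^ξ_β … ζ ∈ C₀^∞(Δ̃(y))»* — the quotient is ALWAYS read on a ζ-LOCALISED function); [I] (1.109) p. 35
(the same cut *«x, x′: |x − x′| ≦ 1»*); [4] (2.137) p. 247 (the pair parameter `t = |x − x′| ∕ L^j ≦ 1`), Prop. 2.2 (2.67) p. 234.

WHY THIS FILE (seat node00-def-Y g20; the «PROBE-PAIRS-UNCUT one level down» question of dag-n06-w3 OBS-1 ∕ dag-n06-l, bus 2026-08-28).
def-Y's `Node00/OpsYOfLetters` carries TWO (3.40) readers.  The BOND reader `holderQB par α ζ Ψ` sums ONLY over `B6KLevelCensusIndexV1.Adm`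
pairs (same direction, `|x − x′|_∞ ≤ L^{j(y(x))}` and `≤ L^{j(y(x′))}`, so `tpar ≤ 1`): print's cut «|x − x′| ≦ 1 on the ξ-lattice» VERBATIM.
The SITE reader `hqS par α Ψ = sup_{z ≠ z′} ‖R(U(Γ_{z,z′}))Ψ(z′) − Ψ(z)‖ ∕ (η|z′ − z|_T)^α` (T11's `hqTP` convention with the transporter) sums
over ALL pairs of the member torus (physical side `M_h·L·P_μ ≥ 4`, so pairs beyond physical distance `1` exist): UNCUT — a STRONGER reading than
print's.  It is harmless for every def-Y use (`hLatS`, `kernelFamilyS.h1 ∕ .h2` apply `hqS` to `z ↦ (ζ(z)η)•(…)`): on a FAR pair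
(`η|z′ − z|_T ≥ 1`, `α ≥ 0`) the denominator is `≥ 1`, so the quotient of `ζΨ` is at most `|ζ(z)|‖Ψ(z)‖ + |ζ(z′)|‖R(U(Γ_{z,z′}))Ψ(z′)‖` — two
POINT terms living on `supp ζ ⊂ Δ̃(y)`, dominated by the (3.42) sup entries (at `U ↦ 1`, `R = id`, by `2|ζ|·sup_{Δ̃(y)}‖Ψ‖`; in the tree:
`B9Cor35ComparisonsGpCAtLetters.hqS_one_liftY_le ∕ hLatS_one_le ∕ hGp_h1_opsYOfLetters` + T11 `prop22_holderEntries_kLevelTorusP_unif`).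
THIS FILE makes that census CITABLE for the authors of cut probe carriers (dag-n06-d `holderProbesK ∕ holderProbesS`) and of `U ↦ 1` inhabitants:
* §1 the physical torus distance `pdist z z′ = η|z′ − z|_T` and the (3.40) denominator `denS α z z′ = pdist^α` (`pdist_nonneg`, `denS_nonneg`,
  ★ `one_le_denS_of_far`);
* §2 the site reader's API: `hqS_nonneg`, ★ `pair_le_hqS`, ★ `hqS_le_of_forall`;
* §3 FAR PAIRS: `div_denS_le_of_far`, ★ `quotS_le_of_far` (far quotient ≤ two point terms), ★★ `hqS_le_of_near_far` (a near-pair quotient bound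
  and far POINT bounds give an `hqS` bound — threshold `r ≥ 1` in print's units), ★★ `hqS_smul_le_of_near_far` (the ζ-localised form: the far
  side is `2·sup|ζ|·P`, `P` bounding `‖Ψ‖` on `supp ζ` and the transported values `‖R(U(Γ_{z,z′}))Ψ(z′)‖`, `z′ ∈ supp ζ`, `z` far),
  ★ `hqS_le_of_near_of_contract` (contracting transport, e.g. `U ↦ 1`: far side `2·sup‖Ψ‖`);
* §4 the CUT reader `hqSCut r par α Ψ` (pairs with `pdist < r` only): `hqSCut_nonneg`, `pair_le_hqSCut`, `hqSCut_le_of_forall`, ★ `hqSCut_le_hqS`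
  («cut ≤ uncut»), ★★ `hqS_le_hqSCut_add` («uncut ≤ cut + 2·sup‖Ψ‖» under contracting transport), `hqS_one_le_hqSCut_add` (`U ↦ 1`);
* §5 the bond reader's API: `holderQB_nonneg`, ★ `pair_le_holderQB` (ADMISSIBLE pairs), ★★ `holderQB_le_of_forall_adm` — the intro rule quantifies
  over `Adm` pairs ONLY («already cut»: a probe carrier restricted to admissible pairs serves `holderQB` verbatim), `tpar_le_one_of_adm` (re-export).
HONEST SCOPE.  Elementary real-analysis bookkeeping over def-Y's landed definitions (`iSup` over finite pair types, `Real.rpow` monotonicity,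
`‖a − b‖ ≤ ‖a‖ + ‖b‖`); NO definition of `Node00/OpsYOfLetters` is touched (the readers stay as landed: site UNCUT, bond ADM-CUT); nothing of [B9]
or [4] is asserted; no unitarity of transporters is used (contracting transport is an explicit HYPOTHESIS where it appears); COUNT-NEUTRAL; N06 NOT
discharged; one finite 𝕋^{d+1} programme at fixed ε — nothing continuum, nothing about OS or the mass gap ∕ Clay.
Cell `pub-ymgap` (HUMAN RULING D-0062), unit `pub-ymgap-node00-def-Y` (g20), 2026-08-28; referee ref-E ∕ ref-H.
-/

noncomputable section

namespace Literature.MathematicalPhysics.QuantumFieldTheory.Balaban1983to89.Node00.OpsYHolderFar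

open LatticeFieldCalculus (supDist)
open B9Eq39Adjoint (R R_one R_smul R_zero)
open B4TorusKernel.MultiPeriod (torusSupNorm torusSupNorm_nonneg)
open B6GlobalChartV1 (PV)
open B6KLevelCensusIndexV1 (KIdx Adm tpar tpar_le_one)
open B6MultiLevelTorusOperator (one_le_N0)
open B6Prop22KLevelTorusCensusEta (nKT nKT_pos)
open Node00 (SiteY FBondY toKT hqS holderQB)

variable {d ℓ : ℕ} {hd : 1 ≤ d + 1} {hL : Odd (ℓ + 1) ∧ 1 < ℓ + 1} {b₀ b₁ : ℝ}
variable {𝔸 : Type} [NormedRing 𝔸]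
variable (i : KIdx d ℓ hd hL b₀ b₁)

/-! ## §1 Print's physical torus distance and the (3.40) denominator -/

/-- **print's physical torus distance between two fine sites**: `η·|z′ − z|_T` (`η = L^{−k}`, `|·|_T` the torus sup-distance) — the base of the
(3.40) denominator inside `hqS`. [cite: Balaban1985BackgroundPropagators, (3.40) p.397 («the η-scale is used»), dictionary] -/
def pdist (z z' : SiteY i) : ℝ := torusSupNorm (toKT i).NB (z'.1 - z.1) / (((nKT (toKT i) : ℕ) : ℝ))

/-- **the (3.40) denominator** `(η|z′ − z|_T)^α` of the site quotient `hqS`. [cite: Balaban1985BackgroundPropagators, (3.40) p.397, dictionary] -/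
def denS (α : ℝ) (z z' : SiteY i) : ℝ := pdist i z z' ^ α

/-- the torus sides are `≥ 1`. [cite: Balaban1984PropagatorsII, (2.1) p.224, bookkeeping] -/
theorem one_le_NB (μ : Fin (d + 1)) : 1 ≤ (toKT i).NB μ := one_le_N0 (toKT i).hMh (toKT i).hP μ

/-- `0 ≤ η|z′ − z|_T`. [cite: Balaban1985BackgroundPropagators, (3.40) p.397, bookkeeping] -/
theorem pdist_nonneg (z z' : SiteY i) : 0 ≤ pdist i z z' :=
  div_nonneg (torusSupNorm_nonneg (one_le_NB i) _) (nKT_pos (toKT i)).le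

/-- `0 ≤ (η|z′ − z|_T)^α`. [cite: Balaban1985BackgroundPropagators, (3.40) p.397, bookkeeping] -/
theorem denS_nonneg (α : ℝ) (z z' : SiteY i) : 0 ≤ denS i α z z' := Real.rpow_nonneg (pdist_nonneg i z z') _

/-- ★ **FAR PAIRS HAVE DENOMINATOR `≥ 1`**: `1 ≤ η|z′ − z|_T` and `0 ≤ α` give `1 ≤ (η|z′ − z|_T)^α` — the one fact that turns a far quotient into
point terms. [cite: Balaban1985BackgroundPropagators, (3.40) p.397 («x, x′: |x − x′| ≦ 1»), bookkeeping] -/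
theorem one_le_denS_of_far {α : ℝ} (hα : 0 ≤ α) {z z' : SiteY i} (hfar : 1 ≤ pdist i z z') : 1 ≤ denS i α z z' :=
  Real.one_le_rpow hfar hα

/-! ## §2 The site reader `hqS`: intro ∕ elim rules -/

/-- `0 ≤ hqS`. [cite: Balaban1985BackgroundPropagators, (3.40) p.397, bookkeeping] -/
theorem hqS_nonneg (par : SiteY i → SiteY i → 𝔸ˣ) (α : ℝ) (Ψ : SiteY i → 𝔸) : 0 ≤ hqS i par α Ψ := by
  classical
  unfold hqS
  refine Real.iSup_nonneg fun p => ?_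
  split_ifs
  · exact div_nonneg (norm_nonneg _) (denS_nonneg i α p.1 p.2)
  · exact le_rfl

/-- ★ **every pair is below the sup**: `‖R(U(Γ_{z,z′}))Ψ(z′) − Ψ(z)‖ ∕ (η|z′ − z|_T)^α ≤ hqS` for `z ≠ z′` (ANY pair of the torus — the reader is
uncut). [cite: Balaban1985BackgroundPropagators, (3.40) p.397, bookkeeping] -/
theorem pair_le_hqS (par : SiteY i → SiteY i → 𝔸ˣ) (α : ℝ) (Ψ : SiteY i → 𝔸) {z z' : SiteY i} (hne : z ≠ z') :
    ‖R (par z z') (Ψ z') - Ψ z‖ / denS i α z z' ≤ hqS i par α Ψ := by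
  classical
  unfold hqS
  refine le_ciSup_of_le (Finite.bddAbove_range _) (z, z') ?_
  dsimp only
  rw [if_pos hne]
  exact le_rfl

/-- ★ **intro rule**: a bound `B ≥ 0` on every pair quotient bounds `hqS`. [cite: Balaban1985BackgroundPropagators, (3.40) p.397, bookkeeping] -/
theorem hqS_le_of_forall (par : SiteY i → SiteY i → 𝔸ˣ) (α : ℝ) (Ψ : SiteY i → 𝔸) {B : ℝ} (hB : 0 ≤ B)
    (h : ∀ z z' : SiteY i, z ≠ z' → ‖R (par z z') (Ψ z') - Ψ z‖ / denS i α z z' ≤ B) : hqS i par α Ψ ≤ B := by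
  classical
  unfold hqS
  refine Real.iSup_le (fun p => ?_) hB
  split_ifs with hne
  · exact h p.1 p.2 hne
  · exact hB

/-! ## §3 Far pairs are point terms -/

/-- on a far pair a quotient is at most its numerator. [cite: Balaban1985BackgroundPropagators, (3.40) p.397, bookkeeping] -/
theorem div_denS_le_of_far {α : ℝ} (hα : 0 ≤ α) {z z' : SiteY i} (hfar : 1 ≤ pdist i z z') {a : ℝ} (ha : 0 ≤ a) :
    a / denS i α z z' ≤ a :=
  div_le_self ha (one_le_denS_of_far i hα hfar)

/-- ★ **THE FAR QUOTIENT IS TWO POINT TERMS**: for `η|z′ − z|_T ≥ 1`, `α ≥ 0`: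
`‖R(g)Ψ(z′) − Ψ(z)‖ ∕ (η|z′ − z|_T)^α ≤ ‖R(g)Ψ(z′)‖ + ‖Ψ(z)‖`. [cite: Balaban1985BackgroundPropagators, (3.40) p.397 + (3.42) p.397, bookkeeping] -/
theorem quotS_le_of_far {α : ℝ} (hα : 0 ≤ α) {z z' : SiteY i} (hfar : 1 ≤ pdist i z z') (g : 𝔸ˣ) (Ψ : SiteY i → 𝔸) :
    ‖R g (Ψ z') - Ψ z‖ / denS i α z z' ≤ ‖R g (Ψ z')‖ + ‖Ψ z‖ :=
  (div_denS_le_of_far i hα hfar (norm_nonneg _)).trans (norm_sub_le _ _)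

/-- ★★ **THE NEAR ∕ FAR INTRO RULE** (threshold `r ≥ 1` in print's units): if every NEAR pair (`η|z′ − z|_T < r`) has quotient `≤ B` and on every
FAR pair (`r ≤ η|z′ − z|_T`) the two point terms satisfy `‖R(U(Γ_{z,z′}))Ψ(z′)‖ + ‖Ψ(z)‖ ≤ B`, then `hqS ≤ B` — the uncut reader is served by
near quotients plus point values. [cite: Balaban1985BackgroundPropagators, (3.40) p.397 («|x − x′| ≦ 1») + (3.42)–(3.43) pp.397–398, bookkeeping] -/
theorem hqS_le_of_near_far (par : SiteY i → SiteY i → 𝔸ˣ) {α : ℝ} (hα : 0 ≤ α) (Ψ : SiteY i → 𝔸) {r B : ℝ} (hr : 1 ≤ r) (hB : 0 ≤ B)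
    (hnear : ∀ z z' : SiteY i, z ≠ z' → pdist i z z' < r → ‖R (par z z') (Ψ z') - Ψ z‖ / denS i α z z' ≤ B)
    (hfar : ∀ z z' : SiteY i, r ≤ pdist i z z' → ‖R (par z z') (Ψ z')‖ + ‖Ψ z‖ ≤ B) :
    hqS i par α Ψ ≤ B := by
  refine hqS_le_of_forall i par α Ψ hB fun z z' hne => ?_
  rcases lt_or_ge (pdist i z z') r with hlt | hle
  · exact hnear z z' hne hlt
  · exact (quotS_le_of_far i hα (hr.trans hle) (par z z') Ψ).trans (hfar z z' hle)

/-- ★ **CONTRACTING TRANSPORT** (e.g. `U ↦ 1`, or isometric conjugation): if `‖R(U(Γ_{z,z′}))a‖ ≤ ‖a‖`, `‖Ψ‖ ≤ P` pointwise, every near pair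
has quotient `≤ B` and `2P ≤ B`, then `hqS ≤ B`. [cite: Balaban1985BackgroundPropagators, (3.40) p.397 + Cor. 3.5 p.407 (U = 1), bookkeeping] -/
theorem hqS_le_of_near_of_contract (par : SiteY i → SiteY i → 𝔸ˣ) {α : ℝ} (hα : 0 ≤ α) (Ψ : SiteY i → 𝔸) {r B P : ℝ} (hr : 1 ≤ r)
    (hR : ∀ (z z' : SiteY i) (a : 𝔸), ‖R (par z z') a‖ ≤ ‖a‖) (hP : ∀ z, ‖Ψ z‖ ≤ P)
    (hnear : ∀ z z' : SiteY i, z ≠ z' → pdist i z z' < r → ‖R (par z z') (Ψ z') - Ψ z‖ / denS i α z z' ≤ B)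
    (hB : 2 * P ≤ B) : hqS i par α Ψ ≤ B := by
  have hP0 : 0 ≤ P := (norm_nonneg _).trans (hP (toKT i).origin)
  have hB0 : 0 ≤ B := le_trans (by positivity) hB
  refine hqS_le_of_near_far i par hα Ψ hr hB0 hnear fun z z' _ => ?_
  linarith [(hR z z' (Ψ z')).trans (hP z'), hP z]

section Localised
variable [NormedAlgebra ℂ 𝔸]

/-- ★★ **THE ζ-LOCALISED FORM** (how every def-Y use reads: `hqS` of `z ↦ ζ(z)•Ψ(z)`).  Let `|ζ| ≤ C₀`; let `P ≥ 0` bound `‖Ψ(z)‖` at the sites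
where `ζ(z) ≠ 0` AND the transported values `‖R(U(Γ_{z,z′}))Ψ(z′)‖` for `ζ(z′) ≠ 0` and `z` far (`r ≤ η|z′ − z|_T`); if every near pair has
quotient `≤ B` and `2·C₀·P ≤ B`, then `hqS (ζ•Ψ) ≤ B`.  (At `U ↦ 1` the transported values are plain values; `P` is a (3.42) sup entry on
`supp ζ ⊂ Δ̃(y)`.) [cite: Balaban1985BackgroundPropagators, (3.43) p.398 («ζ ∈ C₀^∞(Δ̃(y))») + (3.40), (3.42) p.397, bookkeeping] -/
theorem hqS_smul_le_of_near_far (par : SiteY i → SiteY i → 𝔸ˣ) {α : ℝ} (hα : 0 ≤ α) (c : SiteY i → ℝ) (Ψ : SiteY i → 𝔸)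
    {r B C₀ P : ℝ} (hr : 1 ≤ r) (hC : ∀ z, |c z| ≤ C₀) (hP0 : 0 ≤ P)
    (hPz : ∀ z, c z ≠ 0 → ‖Ψ z‖ ≤ P)
    (hPt : ∀ z z', c z' ≠ 0 → r ≤ pdist i z z' → ‖R (par z z') (Ψ z')‖ ≤ P)
    (hnear : ∀ z z' : SiteY i, z ≠ z' → pdist i z z' < r →
      ‖R (par z z') ((((c z' : ℝ) : ℂ)) • Ψ z') - (((c z : ℝ) : ℂ)) • Ψ z‖ / denS i α z z' ≤ B)
    (hB : 2 * C₀ * P ≤ B) :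
    hqS i par α (fun z => (((c z : ℝ) : ℂ)) • Ψ z) ≤ B := by
  have hC0 : 0 ≤ C₀ := (abs_nonneg _).trans (hC (toKT i).origin)
  have hB0 : 0 ≤ B := le_trans (by positivity) hB
  -- `‖(c : ℂ)•X‖ = |c|·‖X‖` (as in `B9Thm37CubeCoverCommutatorSizes.norm_ofReal_smul`)
  have norm_real_smul : ∀ (c : ℝ) (X : 𝔸), ‖((c : ℝ) : ℂ) • X‖ = |c| * ‖X‖ := fun c X => by
    rw [norm_smul, Complex.norm_real, Real.norm_eq_abs]
  refine hqS_le_of_near_far i par hα _ hr hB0 hnear fun z z' hle => ?_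
  -- the two point terms on a far pair, each `≤ C₀·P` (or `0` off `supp ζ`)
  have h1 : ‖R (par z z') ((((c z' : ℝ) : ℂ)) • Ψ z')‖ ≤ C₀ * P := by
    rw [R_smul, norm_real_smul]
    by_cases hz' : c z' = 0
    · rw [hz', abs_zero, zero_mul]; exact mul_nonneg hC0 hP0
    · exact mul_le_mul (hC z') (hPt z z' hz' hle) (norm_nonneg _) hC0
  have h2 : ‖(((c z : ℝ) : ℂ)) • Ψ z‖ ≤ C₀ * P := by
    rw [norm_real_smul]
    by_cases hz : c z = 0
    · rw [hz, abs_zero, zero_mul]; exact mul_nonneg hC0 hP0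
    · exact mul_le_mul (hC z) (hPz z hz) (norm_nonneg _) hC0
  linarith

end Localised

/-! ## §4 The cut reader `hqSCut` and «cut ≤ uncut ≤ cut + point terms» -/

open Classical in
/-- **the CUT site quotient**: the same sup restricted to pairs at physical torus distance `< r` (print's (3.40) is the cut at `r = 1`, read with
`≦`; the strict `<` keeps the complement «far» closed under `r ≤ ·`). [cite: Balaban1985BackgroundPropagators, (3.40) p.397 («x, x′: |x − x′| ≦ 1»)] -/
def hqSCut (r : ℝ) (par : SiteY i → SiteY i → 𝔸ˣ) (α : ℝ) (Ψ : SiteY i → 𝔸) : ℝ :=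
  ⨆ p : SiteY i × SiteY i, if p.1 ≠ p.2 ∧ pdist i p.1 p.2 < r then ‖R (par p.1 p.2) (Ψ p.2) - Ψ p.1‖ / denS i α p.1 p.2 else 0

/-- `0 ≤ hqSCut`. [cite: Balaban1985BackgroundPropagators, (3.40) p.397, bookkeeping] -/
theorem hqSCut_nonneg (r : ℝ) (par : SiteY i → SiteY i → 𝔸ˣ) (α : ℝ) (Ψ : SiteY i → 𝔸) : 0 ≤ hqSCut i r par α Ψ := by
  classical
  unfold hqSCut
  refine Real.iSup_nonneg fun p => ?_
  split_ifs
  · exact div_nonneg (norm_nonneg _) (denS_nonneg i α p.1 p.2)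
  · exact le_rfl

/-- a near pair is below the cut sup. [cite: Balaban1985BackgroundPropagators, (3.40) p.397, bookkeeping] -/
theorem pair_le_hqSCut (r : ℝ) (par : SiteY i → SiteY i → 𝔸ˣ) (α : ℝ) (Ψ : SiteY i → 𝔸) {z z' : SiteY i} (hne : z ≠ z')
    (hlt : pdist i z z' < r) : ‖R (par z z') (Ψ z') - Ψ z‖ / denS i α z z' ≤ hqSCut i r par α Ψ := by
  classical
  unfold hqSCut
  refine le_ciSup_of_le (Finite.bddAbove_range _) (z, z') ?_
  dsimp only
  rw [if_pos ⟨hne, hlt⟩]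

/-- intro rule for the cut reader: a bound `B ≥ 0` on every NEAR pair quotient bounds `hqSCut`. [cite: Balaban1985BackgroundPropagators, (3.40) p.397, bookkeeping] -/
theorem hqSCut_le_of_forall (r : ℝ) (par : SiteY i → SiteY i → 𝔸ˣ) (α : ℝ) (Ψ : SiteY i → 𝔸) {B : ℝ} (hB : 0 ≤ B)
    (h : ∀ z z' : SiteY i, z ≠ z' → pdist i z z' < r → ‖R (par z z') (Ψ z') - Ψ z‖ / denS i α z z' ≤ B) :
    hqSCut i r par α Ψ ≤ B := by
  classical
  unfold hqSCut
  refine Real.iSup_le (fun p => ?_) hB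
  split_ifs with hp
  · exact h p.1 p.2 hp.1 hp.2
  · exact hB

/-- ★ **«CUT ≤ UNCUT»**: `hqSCut r ≤ hqS` for every threshold. [cite: Balaban1985BackgroundPropagators, (3.40) p.397, bookkeeping] -/
theorem hqSCut_le_hqS (r : ℝ) (par : SiteY i → SiteY i → 𝔸ˣ) (α : ℝ) (Ψ : SiteY i → 𝔸) : hqSCut i r par α Ψ ≤ hqS i par α Ψ :=
  hqSCut_le_of_forall i r par α Ψ (hqS_nonneg i par α Ψ) fun _ _ hne _ => pair_le_hqS i par α Ψ hne

/-- the cut reader is monotone in the threshold. [cite: Balaban1985BackgroundPropagators, (3.40) p.397, bookkeeping] -/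
theorem hqSCut_mono {r r' : ℝ} (hrr : r ≤ r') (par : SiteY i → SiteY i → 𝔸ˣ) (α : ℝ) (Ψ : SiteY i → 𝔸) :
    hqSCut i r par α Ψ ≤ hqSCut i r' par α Ψ :=
  hqSCut_le_of_forall i r par α Ψ (hqSCut_nonneg i r' par α Ψ) fun _ _ hne hlt => pair_le_hqSCut i r' par α Ψ hne (hlt.trans_le hrr)

/-- ★★ **«UNCUT ≤ CUT + POINT TERMS»** under contracting transport: for `r ≥ 1`, `α ≥ 0` and `‖R(U(Γ))a‖ ≤ ‖a‖`,
`hqS ≤ hqSCut r + 2·sup_z ‖Ψ(z)‖` — the uncut (3.40) reading exceeds print's cut one by at most twice a (3.42) sup entry.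
[cite: Balaban1985BackgroundPropagators, (3.40) + (3.42) p.397, (3.43) p.398, bookkeeping] -/
theorem hqS_le_hqSCut_add (par : SiteY i → SiteY i → 𝔸ˣ) {α : ℝ} (hα : 0 ≤ α) (Ψ : SiteY i → 𝔸) {r : ℝ} (hr : 1 ≤ r)
    (hR : ∀ (z z' : SiteY i) (a : 𝔸), ‖R (par z z') a‖ ≤ ‖a‖) :
    hqS i par α Ψ ≤ hqSCut i r par α Ψ + 2 * ⨆ z, ‖Ψ z‖ := by
  have hsup : ∀ z, ‖Ψ z‖ ≤ ⨆ z, ‖Ψ z‖ := fun z => le_ciSup (f := fun z => ‖Ψ z‖) (Finite.bddAbove_range _) z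
  have hS0 : 0 ≤ ⨆ z, ‖Ψ z‖ := Real.iSup_nonneg fun _ => norm_nonneg _
  have hc0 := hqSCut_nonneg i r par α Ψ
  refine hqS_le_of_near_far i par hα Ψ hr (by positivity) (fun z z' hne hlt => ?_) fun z z' _ => ?_
  · exact (pair_le_hqSCut i r par α Ψ hne hlt).trans (le_add_of_nonneg_right (by positivity))
  · linarith [(hR z z' (Ψ z')).trans (hsup z'), hsup z]

/-- **at `U ↦ 1`** (trivial transporters): `hqS ≤ hqSCut r + 2·sup‖Ψ‖`. [cite: Balaban1985BackgroundPropagators, Cor. 3.5 p.407 (U = 1) + (3.40) p.397, bookkeeping] -/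
theorem hqS_one_le_hqSCut_add {α : ℝ} (hα : 0 ≤ α) (Ψ : SiteY i → 𝔸) {r : ℝ} (hr : 1 ≤ r) :
    hqS i (fun _ _ => 1) α Ψ ≤ hqSCut i r (fun _ _ => 1) α Ψ + 2 * ⨆ z, ‖Ψ z‖ :=
  hqS_le_hqSCut_add i _ hα Ψ hr fun _ _ a => by rw [R_one]

/-! ## §5 The bond reader `holderQB`: intro ∕ elim rules over ADMISSIBLE pairs («already cut») -/

section Bond
variable [NormedAlgebra ℂ 𝔸]

/-- `0 ≤ holderQB`. [cite: Balaban1985BackgroundPropagators, (3.40) p.397, bookkeeping] -/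
theorem holderQB_nonneg (par : Site (PV d ℓ i.m i.K hd hL) 0 → Site (PV d ℓ i.m i.K hd hL) 0 → 𝔸ˣ) (α : ℝ)
    (ζ : FBondY i → ℝ) (Ψ : FBondY i → 𝔸) : 0 ≤ holderQB i par α ζ Ψ := by
  classical
  unfold holderQB
  refine Real.iSup_nonneg fun q => ?_
  split_ifs
  · exact mul_nonneg (Real.rpow_nonneg (by positivity) _) (norm_nonneg _)
  · exact le_rfl

/-- ★ **every ADMISSIBLE pair is below the bond sup**. [cite: Balaban1985BackgroundPropagators, (3.40) p.397; Balaban1984PropagatorsII, (2.137) p.247, bookkeeping] -/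
theorem pair_le_holderQB (par : Site (PV d ℓ i.m i.K hd hL) 0 → Site (PV d ℓ i.m i.K hd hL) 0 → 𝔸ˣ) (α : ℝ)
    (ζ : FBondY i → ℝ) (Ψ : FBondY i → 𝔸) {x x' : FBondY i} (hadm : Adm i x x') :
    ((((supDist x.src x'.src : ℕ) : ℝ)) * |i.cf|⁻¹) ^ (-α) * ‖((ζ x : ℝ) : ℂ) • Ψ x - R (par x.src x'.src) (((ζ x' : ℝ) : ℂ) • Ψ x')‖
      ≤ holderQB i par α ζ Ψ := by
  classical
  unfold holderQB
  refine le_ciSup_of_le (Finite.bddAbove_range _) (x, x') ?_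
  dsimp only
  rw [if_pos hadm]

/-- ★★ **intro rule over ADMISSIBLE pairs ONLY**: a bound `B ≥ 0` on the weighted covariant difference at every `Adm` pair (same direction,
`|x − x′|_∞ ≤ L^{j(y(x))}` and `≤ L^{j(y(x′))}` — print's «|x − x′| ≦ 1 on the ξ-lattice») bounds `holderQB`; non-admissible pairs are never read.
[cite: Balaban1985BackgroundPropagators, (3.40) p.397 («x, x′: |x − x′| ≦ 1», scale ξ); Balaban1984PropagatorsII, (2.137) p.247, bookkeeping] -/
theorem holderQB_le_of_forall_adm (par : Site (PV d ℓ i.m i.K hd hL) 0 → Site (PV d ℓ i.m i.K hd hL) 0 → 𝔸ˣ)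
    (α : ℝ) (ζ : FBondY i → ℝ) (Ψ : FBondY i → 𝔸) {B : ℝ} (hB : 0 ≤ B)
    (h : ∀ x x' : FBondY i, Adm i x x' →
      ((((supDist x.src x'.src : ℕ) : ℝ)) * |i.cf|⁻¹) ^ (-α) * ‖((ζ x : ℝ) : ℂ) • Ψ x - R (par x.src x'.src) (((ζ x' : ℝ) : ℂ) • Ψ x')‖ ≤ B) :
    holderQB i par α ζ Ψ ≤ B := by
  classical
  unfold holderQB
  refine Real.iSup_le (fun q => ?_) hB
  split_ifs with hadm
  · exact h q.1 q.2 hadm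
  · exact hB

/-- **admissible pairs are near** (re-export of `B6KLevelCensusIndexV1.tpar_le_one` for pin authors): on an `Adm` pair the pair parameter
`t = |x − x′|_∞ ∕ L^{j(y(x))}` is `≤ 1`. [cite: Balaban1984PropagatorsII, (2.137) p.247; Balaban1985BackgroundPropagators, (3.40) p.397, bookkeeping] -/
theorem tpar_le_one_of_adm {x x' : FBondY i} (hadm : Adm i x x') : tpar i x x' ≤ 1 := tpar_le_one i hadm

end Bond

end Literature.MathematicalPhysics.QuantumFieldTheory.Balaban1983to89.Node00.OpsYHolderFar

end
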